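import Summits.QuantumFields.YangMills.Theorems.BalabanUVNodesN18KingModelTorus
import Literature.MathematicalPhysics.QuantumFieldTheory.King1986.MinimizerDecayUniform
import Literature.MathematicalPhysics.QuantumFieldTheory.King1986.ContinuumLimitStatements

/-!
# BalabanUVNodes ∕ N18 — King's (3.73), FIRST BOUND, `j ≥ 1`, FOR KING'S ACTUAL OPERATORS ON BAŁABAN'S TORI — THE
# MASS-UNIFORM EDITION: `κ, C₅` functions of `(d, L, a, m₀², γ)` ONLY, EVERY domain reading ITS OWN mass in `(0, m₀²]`,
# in particular King's PHYSICAL slice masses `m²(L^jη)²` of (2.20) (Track A, DAG node N18 = NE5 `T4OutputRate.NE5 EA EB W κ θ C₅`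
# :211; cluster K4; row s3 «King-model transfer `N18KingModelTorus` (κ, C₅ from (d, L, a, m², γ))»; module 12 of seat
# pub-ymgap-dag-n18-e (g9), `--supports stmt-QuantumFields-19912 --as helper` = K3‴ `SpineGivenEndpointR13`)

HONEST FRAMING.  Count-neutral kernel bookkeeping.  King's A = 0 scalar MODEL of the NE5 mechanism on finite tori (template
literature, published and proved) — NOT Bałaban's covariant one-step outputs `E^{(j)}(X; g, U)`, for which NE5 is NOT IN PRINT and
has no tree producer; NOT a node discharge; nothing continuum ∕ ℝ⁴ ∕ OS ∕ mass-gap ∕ Clay.  THEOREMS ONLY: 0 `def`, 0 `sorry`,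
standard axioms.

THE POINT.  The row's theorem of record `N18KingModelTorus.ne5_kingModel_threeFactor_torus` (p418046) delivers `κ > 0`, `C₅ ≥ 0`
«functions of `d, L, a, m², γ` only» and reads King's three-factor graphs with ONE lattice-unit mass `m²` at EVERY scale `j`.
By King's rescaling (2.20) p. 654 the slice `G^ε_{(j)}` of the decomposition (2.17) of `G^η_k` carries, in scale-`j` lattice
units, the mass `m²(L^jη)²` — a DIFFERENT number at every scale, all in `(0, m²]` — so p418046 speaks of unphysical masses across
scales, and its constants (from [Ba 4] (1.10) through n18-b's `MinimizerBlockDecay`) were not stated uniformly in the mass.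
Seat n15-e (g5) moved the mass INSIDE the roots — `B4Thm110ZeroTorusUniform.thm110_zero_torus_unif` (p496123),
`King1986/MinimizerDecayUniform` (p496625) — and re-ran N15's slice family at the physical masses (`N15KingModelSlicesExactMass`).
THIS FILE is N18's twin of that step:
* §1 `minimiser_row_decay_unif` ∕ `minimiser_row_rate_unif` — the outer-line read-out shapes of `MinimizerBlockDecay` §5 with
  `∀ m² ≤ m₀²` INSIDE the `∃ δ₀ c₀` (corollaries of n15-e's two `_unif` theorems; columns = rows by `tdistT_symm`).
* §2 `ne5_of_threeFactorRates_lemma45_massProfile` — `N18KingModelScales.ne5_of_threeFactorRates_lemma45` (p415038) re-run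
  with a MASS PROFILE `mass : C.Dom → ℝ`, `0 < mass X` (its middle letters `γ₀, κ′, K₄₅, δ₄₅` never depended on the mass).
* §3 **`ne5_kingModel_threeFactor_torus_unif`** — `κ > 0`, `C₅ ≥ 0` functions of `(d, L, a, m₀², γ)` ONLY, such that p418046's
  conclusion `NE5 EA EB W κ (L^{−γ∕2}) C₅` holds for EVERY MASS PROFILE `0 < mass X ≤ m₀²` read by both runs at `X`.
* §4 **`ne5_kingModel_threeFactor_torus_physMass`** — §3 at King's PHYSICAL profile `mass X = m²·(L^{scale X}·eps L k)²`
  (`= m²(L^jη)²`, the shape of n15-e's `physMass_eq_slice_sq`) for a run of `k ≥ scale X` steps; ONE `(κ, C₅)` for all `k`.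
HONEST SCOPE.  (i) `A = 0`, periodic b.c., odd `L ≥ 3`, `m² > 0`, flat blocks; (ii) lattice units of scale `j` (the factor
`(L^jη)^{2−d}` of (2.20) is NOT inserted); (iii) «one lattice mass at all scales» — GONE; (iv) `j ≥ 1`; (v) derivative ∕ Hölder
lines: the same re-run once `_unif` twins of `MinimizerTwoSpacingDeriv`∕`…Holder` exist — not here; (vi) not Bałaban's
`E^{(j)}(X; g, U)`; not a discharge.  Inputs BY NAME: `minimiser_kernel_decay_blocks_unif`, `king_prop38_torus_blocks_unif`,
`ne5_of_threeFactorRates`, `king_cov_decay_torus`, `king_lemma45_torus`, `aminL_le_aK`, `outerRate_le_unif`, `blockOf_over`,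
`tdistT_sumBound`, `exp_decay_mono`, `inv_pow_le_kingTheta_pow`, `delta45_le_kapCT`.

Sources: C. King, Commun. Math. Phys. **102** (1986) 649–677 [King1986] — (2.17) p. 653, (2.20) p. 654, Thm 3.3 (3.6)–(3.8)
pp. 655–656, Prop. 3.7 (3.64) p. 663, Prop. 3.8 (3.71) p. 664, Prop. 3.9 (3.73) p. 665, (4.33)–(4.34) and Lemma 4.5 (4.38) p. 674,
(4.42)–(4.43) p. 675; T. Bałaban, Commun. Math. Phys. **89** (1983) 571–597 [Balaban1983RegularityDecay] Thm (1.10) p. 573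
(«constants … depending on d, M only» — the mass-uniform root); T. Bałaban, Commun. Math. Phys. **109** (1987) 249–301
[Balaban1987RG1] (0.24)–(0.25) p. 257 (the only printed trace of NE5).  No claim about the mass gap.
-/

noncomputable section

namespace Summit.QuantumFields.YangMills.BalabanUVNodes.N18KingModelTorusMassUniform

open Real Matrix
open Literature.MathematicalPhysics.QuantumFieldTheory.Balaban1983to89 (Params)
open Literature.MathematicalPhysics.QuantumFieldTheory.Balaban1983to89.T4OutputRate (Carriers Functional NE5)
open Literature.MathematicalPhysics.QuantumFieldTheory.Balaban1983to89.B5Prop11Plancherel (Tor fine)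
open Literature.MathematicalPhysics.QuantumFieldTheory.Balaban1983to89.B4Sect5Proof (latticeConst latticeConst_nonneg)
open Literature.MathematicalPhysics.QuantumFieldTheory.King1986
  (aK aK_le lemma43Const prop38RateConst prop38PosConst exp_decay_mono)
open Literature.MathematicalPhysics.QuantumFieldTheory.King1986.ContinuumLimit (eps eps_pos)
open Literature.MathematicalPhysics.QuantumFieldTheory.King1986.Torus
  (minimiser effLaplacian blockProj blockOf blockOf_over tdistT tdistT_symm tdistT_nonneg tdistT_isPseudoDist tdistT_sumBound
    K45 K45_nonneg delta45 delta45_pos gam0L gam0L_pos kapCT aminL_le_aK king_lemma45_torus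
    minimiser_kernel_decay_blocks_unif king_prop38_torus_blocks_unif)
open Summit.QuantumFields.YangMills.BalabanUVNodes.N18KingModel (kingTheta_pos kingTheta_lt_one)
open Summit.QuantumFields.YangMills.BalabanUVNodes.N18KingModelScales
  (ne5_of_threeFactorRates king_cov_decay_torus inv_pow_le_kingTheta_pow delta45_le_kapCT)
open Summit.QuantumFields.YangMills.BalabanUVNodes.N18KingModelTorus (outerRate_le_unif)

variable {d : ℕ}

/-! ## §1 The outer lines at a common rate, mass INSIDE the constants -/

/-- **Mass-uniform twin of `MinimizerBlockDecay.minimiser_row_decay`** (Theorem 3.3 ∕ Prop. 3.7 (3.64) in block-distance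
currency, weakened to any common rate): for `d ≥ 1`, odd `L > 1`, `a > 0`, a cap `m₀² ≥ 0` there are `δ₀, c₀ > 0` such that
for EVERY `0 ≤ m² ≤ m₀²`, every volume with `K ≥ 1`, every `0 < κ ≤ δ₀`: `|ℋ_K(x, b)| ≤ a·c₀·e^{−κ·tdistT M (B(x)) b}`
(`a_K ≤ a`).  From `minimiser_kernel_decay_blocks_unif`.
[cite: King1986, Theorem 3.3 (3.7) p.656, Prop. 3.7 (3.64) p.663; Balaban1983RegularityDecay, Theorem (1.10) p.573] -/
theorem minimiser_row_decay_unif (dd L : ℕ) (hd : 1 ≤ dd) (hL : Odd L ∧ 1 < L) {a : ℝ} (ha : 0 < a)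
    {m0sq : ℝ} (hm0 : 0 ≤ m0sq) :
    ∃ δ₀ c₀ : ℝ, 0 < δ₀ ∧ 0 < c₀ ∧ ∀ (P : Params), P.d = dd → P.L = L → 1 ≤ P.K →
      ∀ (msq : ℝ), 0 ≤ msq → msq ≤ m0sq →
      ∀ (M : Fin P.d → ℕ) [∀ μ, NeZero (M μ)] (_hMK : ∀ μ, M μ = P.sitesPerDir P.K)
        (N : ℕ) [NeZero N] (_hN : N = P.L ^ P.K) (κ : ℝ), 0 < κ → κ ≤ δ₀ →
        ∀ (xt : Tor (fine N M)) (bt : Tor M),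
        |minimiser N M (aK a P.L P.K) (((N : ℕ) : ℝ) ^ 2) msq (Pi.single bt 1) xt|
          ≤ a * c₀ * Real.exp (-(κ * tdistT M (blockOf N M xt) bt)) := by
  obtain ⟨δ₀, c₀, hδ₀, hc₀, H⟩ := minimiser_kernel_decay_blocks_unif dd L hd hL ha hm0
  refine ⟨δ₀, c₀, hδ₀, hc₀, ?_⟩
  intro P hPd hPL hK msq hmsq hcap M _ hMK N _ hN κ _ hκδ xt bt
  have hLr : (1 : ℝ) < P.L := by exact_mod_cast P.hL.2
  have h1 := H P hPd hPL hK msq hmsq hcap M hMK N hN xt bt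
  have h2 : aK a P.L P.K * c₀ * Real.exp (-(δ₀ * tdistT M (blockOf N M xt) bt))
      ≤ a * c₀ * Real.exp (-(δ₀ * tdistT M (blockOf N M xt) bt)) :=
    mul_le_mul_of_nonneg_right (mul_le_mul_of_nonneg_right (aK_le ha hLr hK) hc₀.le) (Real.exp_pos _).le
  exact (h1.trans h2).trans
    (exp_decay_mono (mul_nonneg ha.le hc₀.le) hκδ (tdistT_nonneg M _ _))

/-- **Mass-uniform twin of `MinimizerBlockDecay.minimiser_row_rate`** (Prop. 3.8 (3.71) line 1 in block-distance currency,
weakened to any rate `κ ≤ δ₀∕2`): for `d ≥ 1`, odd `L ≥ 2`, `a > 0`, a cap `m₀² ≥ 0`, `0 ≤ γ ≤ 1` there are `δ₀, c₀ > 0`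
such that for EVERY `0 < m² ≤ m₀²`, every volume, every `n ≥ 1`, every `0 < κ ≤ δ₀∕2` and fine points `x` under `x′`:
`|ℋ_{K+n}(x′, b) − ℋ_K(x, b)| ≤ √((C₁(K,n) + C₂)(L^K)^{−γ}·2ac₀)·e^{−κ·tdistT M (B(x)) b}`.  From `king_prop38_torus_blocks_unif`.
[cite: King1986, Prop. 3.8 (3.71) p.664] -/
theorem minimiser_row_rate_unif (dd L : ℕ) (hd : 1 ≤ dd) (hLodd : Odd L) (hL : 2 ≤ L) {a : ℝ} (ha : 0 < a)
    {m0sq : ℝ} (hm0 : 0 ≤ m0sq) {γ : ℝ} (hγ0 : 0 ≤ γ) (hγ1 : γ ≤ 1) :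
    ∃ δ₀ c₀ : ℝ, 0 < δ₀ ∧ 0 < c₀ ∧ ∀ (P : Params) (_hPd : P.d = dd) (_hPL : P.L = L) (_hK : 1 ≤ P.K) [NeZero P.L]
      (m2 : ℝ) (_hm : 0 < m2) (_hcap : m2 ≤ m0sq)
      (n : ℕ) (_hn : 1 ≤ n) (M : Fin P.d → ℕ) [∀ μ, NeZero (M μ)] (_hMK : ∀ μ, M μ = P.sitesPerDir P.K)
      (κ : ℝ) (_hκ : 0 < κ) (_hκδ : κ ≤ δ₀ / 2)
      (xt : Tor (fine (P.L ^ P.K) M)) (xt' : Tor (fine (P.L ^ n * P.L ^ P.K) M)) (bt : Tor M)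
      (_hxx : ∀ μ, (xt μ).val = (xt' μ).val / P.L ^ n),
      |minimiser (P.L ^ n * P.L ^ P.K) M (aK a P.L (P.K + n)) (((P.L ^ n * P.L ^ P.K : ℕ) : ℝ) ^ 2) m2
            (Pi.single bt 1) xt'
          - minimiser (P.L ^ P.K) M (aK a P.L P.K) (((P.L ^ P.K : ℕ) : ℝ) ^ 2) m2 (Pi.single bt 1) xt|
        ≤ Real.sqrt (((prop38RateConst a a (lemma43Const a P.L P.K n) ((π ^ 2 / 4) ^ P.d) P.d γ
                + prop38PosConst a ((π ^ 2 / 4) ^ P.d) P.d γ) * ((P.L ^ P.K : ℕ) : ℝ) ^ (-γ)) * (2 * (a * c₀)))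
            * Real.exp (-(κ * tdistT M (blockOf (P.L ^ P.K) M xt) bt)) := by
  obtain ⟨δ₀, c₀, hδ₀, hc₀, H⟩ := king_prop38_torus_blocks_unif dd L hd hLodd hL ha hm0 hγ0 hγ1
  refine ⟨δ₀, c₀, hδ₀, hc₀, ?_⟩
  intro P hPd hPL hK _ m2 hm hcap n hn M _ hMK κ _ hκδ xt xt' bt hxx
  exact (H P hPd hPL hK m2 hm hcap n hn M hMK xt xt' bt hxx).trans
    (exp_decay_mono (Real.sqrt_nonneg _) hκδ (tdistT_nonneg M _ _))

/-! ## §2 (3.73)'s assembly on the torus with a MASS PROFILE: the middle line's letters are mass-free -/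

/-- **`N18KingModelScales.ne5_of_threeFactorRates_lemma45` WITH A MASS PROFILE.**  King's actual middle factors
`C^{(j)} = (Δ^{(j)} + aL⁻²Q*Q)⁻¹`, `C^{(j+n)}` on the scale-`j` torus, read at the domain's OWN mass `mass X > 0` (the two slices
paired by (3.73) have the same physical length `L^jη = L^{j+n}η′`, hence the same lattice mass); outer lines as binders (sizes
`sA`, `sB`, rates `cA·(L^{−γ})^j`, `cB·(L^{−γ})^j`, decay `0 < κ ≤ δ₄₅`).  BY NAME per domain: `king_cov_decay_torus` (size `2∕γ₀`,
decay `κ′ ≥ δ₄₅ ≥ κ`), `king_lemma45_torus` (`K₄₅L^{−j}e^{−δ₄₅·tdist}`, `L^{−j} ≤ (L^{−γ})^j`), `tdistT_sumBound` — the letters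
`γ₀, κ′, K₄₅, δ₄₅` are functions of `(d, a, L)` only, so the conclusion is uniform in the profile.  A = 0 MODEL.
[cite: King1986, Prop. 3.9 (3.73) p.665, (4.42)–(4.43) p.675, (4.33)–(4.34) and Lemma 4.5 (4.38) p.674] -/
theorem ne5_of_threeFactorRates_lemma45_massProfile {C : Carriers} {EA : Functional C C.BgA} {EB : Functional C C.BgB}
    {W : Set (ℕ → ℝ)} (L : ℕ) [NeZero L] (hL : 2 ≤ L) {a : ℝ} (ha : 0 < a)
    (mass : C.Dom → ℝ) (hmass : ∀ X, 0 < mass X)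
    {n : ℕ} (hn : 1 ≤ n) (M : ℕ → Fin d → ℕ) [∀ j μ, NeZero (M j μ)] {γ : ℝ} (hγ1 : γ ≤ 1)
    (hsc : ∀ X : C.Dom, 1 ≤ C.scale X)
    (p r : (X : C.Dom) → Tor (fine L (M (C.scale X))))
    (uA uB vA vB : (X : C.Dom) → Tor (fine L (M (C.scale X))) → ℝ)
    (CA CB : (X : C.Dom) → Matrix (Tor (fine L (M (C.scale X)))) (Tor (fine L (M (C.scale X)))) ℝ)
    (hCAdef : ∀ X, CA X = (effLaplacian (L ^ C.scale X) (fine L (M (C.scale X))) (aK a L (C.scale X))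
          (((L ^ C.scale X : ℕ) : ℝ) ^ 2) (mass X) + (a * ((L : ℝ) ^ 2)⁻¹) • blockProj L (M (C.scale X)))⁻¹)
    (hCBdef : ∀ X, CB X = (effLaplacian (L ^ n * L ^ C.scale X) (fine L (M (C.scale X))) (aK a L (C.scale X + n))
          (((L ^ n * L ^ C.scale X : ℕ) : ℝ) ^ 2) (mass X) + (a * ((L : ℝ) ^ 2)⁻¹) • blockProj L (M (C.scale X)))⁻¹)
    {κ sA sB cA cB : ℝ} (hκ : 0 < κ) (hκδ : κ ≤ delta45 d a L) (hsA : 0 ≤ sA) (hsB : 0 ≤ sB)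
    (hcA : 0 ≤ cA) (hcB : 0 ≤ cB)
    (hu : ∀ X z, |uA X z| ≤ sA * Real.exp (-(κ * tdistT _ (p X) z)))
    (hv : ∀ X w, |vB X w| ≤ sB * Real.exp (-(κ * tdistT _ w (r X))))
    (hdu : ∀ X z, |uB X z - uA X z| ≤ cA * ((L : ℝ) ^ (-γ)) ^ C.scale X * Real.exp (-(κ * tdistT _ (p X) z)))
    (hdv : ∀ X w, |vB X w - vA X w| ≤ cB * ((L : ℝ) ^ (-γ)) ^ C.scale X * Real.exp (-(κ * tdistT _ w (r X))))
    (hd : ∀ X, C.d X ≤ tdistT _ (p X) (r X))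
    (hEA : ∀ g U X, EA g U X = uA X ⬝ᵥ (CA X *ᵥ vA X))
    (hEB : ∀ g U X, EB g U X = uB X ⬝ᵥ (CB X *ᵥ vB X)) :
    NE5 EA EB W (κ / 2) ((L : ℝ) ^ (-γ))
      ((cA * (2 / gam0L d a L) * sB + sA * K45 d a L * sB + sA * (2 / gam0L d a L) * cB)
        * (latticeConst d (κ / 2)) ^ 2) := by
  have hL1 : 1 ≤ L := by omega
  have hθ : 0 ≤ (L : ℝ) ^ (-γ) := (kingTheta_pos hL1 γ).le
  have hγ₀ : 0 < gam0L d a L := gam0L_pos ha hL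
  have hsC : 0 ≤ 2 / gam0L d a L := by positivity
  have hκ' : κ ≤ kapCT d a L := hκδ.trans (delta45_le_kapCT ha hL)
  -- the middle factors' undifferenced decay BY NAME (`king_cov_decay_torus` at the domain's mass), weakened from `κ′` to `κ`
  have hCA : ∀ X z w, |CA X z w| ≤ 2 / gam0L d a L * Real.exp (-(κ * tdistT _ z w)) := by
    intro X z w
    obtain ⟨hlo, hhi⟩ := aminL_le_aK ha hL (hsc X)
    rw [hCAdef]
    exact (king_cov_decay_torus ha (hmass X) hL (L ^ C.scale X) hlo hhi (M (C.scale X)) z w).trans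
      (exp_decay_mono hsC hκ' ((tdistT_isPseudoDist _).nonneg z w))
  have hCB : ∀ X z w, |CB X z w| ≤ 2 / gam0L d a L * Real.exp (-(κ * tdistT _ z w)) := by
    intro X z w
    obtain ⟨hlo, hhi⟩ := aminL_le_aK ha hL (show 1 ≤ C.scale X + n by have := hsc X; omega)
    rw [hCBdef]
    exact (king_cov_decay_torus ha (hmass X) hL (L ^ n * L ^ C.scale X) hlo hhi (M (C.scale X)) z w).trans
      (exp_decay_mono hsC hκ' ((tdistT_isPseudoDist _).nonneg z w))
  -- the middle line's RATE: Lemma 4.5 BY NAME at the domain's mass, `L^{-j} ≤ θ^j`, decay weakened from `δ₄₅` to `κ`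
  have hdC : ∀ X z w, |CB X z w - CA X z w|
      ≤ K45 d a L * ((L : ℝ) ^ (-γ)) ^ C.scale X * Real.exp (-(κ * tdistT _ z w)) := by
    intro X z w
    have h45 := king_lemma45_torus ha (hmass X) hL (hsc X) hn (M (C.scale X)) z w
    rw [hCAdef, hCBdef, abs_sub_comm]
    refine h45.trans ?_
    have hK : 0 ≤ K45 d a L := K45_nonneg a L
    have ht : 0 ≤ tdistT _ z w := (tdistT_isPseudoDist _).nonneg z w
    calc K45 d a L * ((L : ℝ) ^ C.scale X)⁻¹ * Real.exp (-(delta45 d a L * tdistT _ z w))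
        ≤ K45 d a L * ((L : ℝ) ^ (-γ)) ^ C.scale X * Real.exp (-(delta45 d a L * tdistT _ z w)) :=
          mul_le_mul_of_nonneg_right (mul_le_mul_of_nonneg_left (inv_pow_le_kingTheta_pow hL1 hγ1 _) hK)
            (Real.exp_pos _).le
      _ ≤ K45 d a L * ((L : ℝ) ^ (-γ)) ^ C.scale X * Real.exp (-(κ * tdistT _ z w)) :=
          exp_decay_mono (mul_nonneg hK (pow_nonneg hθ _)) hκδ ht
  -- the lattice sums BY NAME (uniform in the torus)
  have hV : ∀ (j : ℕ) (s : Tor (fine L (M j))),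
      ∑ z, Real.exp (-(κ / 2 * tdistT (fine L (M j)) s (id z))) ≤ latticeConst d (κ / 2) :=
    fun j s => tdistT_sumBound (fine L (M j)) (κ / 2) (half_pos hκ) s
  exact ne5_of_threeFactorRates (β := fun j => Tor (fine L (M j))) (P := fun j => Tor (fine L (M j)))
    (fun j => tdistT (fine L (M j))) (fun j => (tdistT_isPseudoDist _).nonneg)
    (fun j => (tdistT_isPseudoDist _).triangle) (fun _ => id) p r uA uB vA vB CA CB hκ.le hθ hsA hsC hsB hcA
    (K45_nonneg a L) hcB hu hCA hCB hv hdu hdC hdv hV hd hEA hEB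

/-! ## §3 (3.73), first bound, `j ≥ 1`, on Bałaban's tori — `κ, C₅` from `(d, L, a, m₀², γ)`, every domain its own mass -/

/-- **KING'S (3.73), FIRST BOUND, `j ≥ 1`, MASS-UNIFORM — the row's theorem of record with the mass quantified INSIDE.**
For `d ≥ 1`, odd `L > 1`, `a > 0`, a cap `m₀² > 0`, `0 ≤ γ ≤ 1` there are `κ > 0`, `C₅ ≥ 0` — functions of `d, L, a, m₀², γ`
ONLY — such that: for every `n ≥ 1`; every scale-indexed family of unit tori `L·M_j(μ) = 2L^{m_j}`; every carriers `C` with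
`1 ≤ scale X` whose domain `X` of scale `j` reads fine points `x_A(X)`, `y_A(X)` (`L^j` per unit side) UNDER `x_B(X)`, `y_B(X)`
(`L^nL^j`) with tree length at most `|B(x_A) − B(y_A)|_{T₁}`; EVERY MASS PROFILE `mass : C.Dom → ℝ`, `0 < mass X ≤ m₀²`; every
two functionals reading the (4.42) three-factor graphs of run A (`Σ_{z,w} ℋ_j(x_A, z)·C^{(j)}(z, w)·ℋ_j(y_A, w)`) and of run B
(`ℋ_{j+n}`, `C^{(j+n)}` at `x_B, y_B`) with King's ACTUAL `A = 0` operators of the tree AT THE MASS `mass X`; every window `W`: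
`NE5 EA EB W κ (L^{−γ∕2}) C₅` — ONE `θ` for all scales, ONE `(κ, C₅)` for all masses under the cap.  Composition:
`ne5_of_threeFactorRates_lemma45_massProfile` at `γ∕2` with `hu`, `hv` ≔ `minimiser_row_decay_unif` (∘ `blockOf_over`,
`tdistT_symm`), `hdu`, `hdv` ≔ `minimiser_row_rate_unif` ∘ `outerRate_le_unif` (∘ `tdistT_symm`), `κ = min(δ₀^{dec}, δ₀^{rate}∕2,
δ₄₅)`.  p418046 = the constant profile `mass X = m²`, cap `m²`.  A = 0 MODEL; periodic b.c.
[cite: King1986, (2.20) p.654, Prop. 3.9 (3.73) p.665, (4.42)–(4.43) p.675, Prop. 3.8 (3.71) p.664, Lemma 4.5 (4.38) p.674,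
Theorem 3.3 (3.7) p.656; Balaban1983RegularityDecay, Theorem (1.10) p.573] -/
theorem ne5_kingModel_threeFactor_torus_unif (hd : 1 ≤ d) (L : ℕ) [NeZero L] (hLp : Odd L ∧ 1 < L) {a : ℝ}
    (ha : 0 < a) {m0sq : ℝ} (hm0 : 0 < m0sq) {γ : ℝ} (hγ0 : 0 ≤ γ) (hγ1 : γ ≤ 1) :
    ∃ κ C₅ : ℝ, 0 < κ ∧ 0 ≤ C₅ ∧
      ∀ (n : ℕ) (_hn : 1 ≤ n) (M : ℕ → Fin d → ℕ) [∀ j μ, NeZero (M j μ)]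
        (_hM : ∀ j, ∃ mm : ℕ, ∀ μ, L * M j μ = 2 * L ^ mm)
        (C : Carriers) (_hsc : ∀ X, 1 ≤ C.scale X)
        (xA yA : (X : C.Dom) → Tor (fine (L ^ C.scale X) (fine L (M (C.scale X)))))
        (xB yB : (X : C.Dom) → Tor (fine (L ^ n * L ^ C.scale X) (fine L (M (C.scale X)))))
        (_hx : ∀ X μ, (xA X μ).val = (xB X μ).val / L ^ n)
        (_hy : ∀ X μ, (yA X μ).val = (yB X μ).val / L ^ n)
        (_hd : ∀ X, C.d X ≤ tdistT (fine L (M (C.scale X)))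
            (blockOf (L ^ C.scale X) (fine L (M (C.scale X))) (xA X))
            (blockOf (L ^ C.scale X) (fine L (M (C.scale X))) (yA X)))
        (mass : C.Dom → ℝ) (_hmass : ∀ X, 0 < mass X) (_hcap : ∀ X, mass X ≤ m0sq)
        (EA : Functional C C.BgA) (EB : Functional C C.BgB)
        (_hEA : ∀ g U X, EA g U X =
          (fun z => minimiser (L ^ C.scale X) (fine L (M (C.scale X))) (aK a L (C.scale X))
              (((L ^ C.scale X : ℕ) : ℝ) ^ 2) (mass X) (Pi.single z 1) (xA X))
            ⬝ᵥ ((effLaplacian (L ^ C.scale X) (fine L (M (C.scale X))) (aK a L (C.scale X))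
                    (((L ^ C.scale X : ℕ) : ℝ) ^ 2) (mass X)
                  + (a * ((L : ℝ) ^ 2)⁻¹) • blockProj L (M (C.scale X)))⁻¹
                *ᵥ fun w => minimiser (L ^ C.scale X) (fine L (M (C.scale X))) (aK a L (C.scale X))
                    (((L ^ C.scale X : ℕ) : ℝ) ^ 2) (mass X) (Pi.single w 1) (yA X)))
        (_hEB : ∀ g U X, EB g U X =
          (fun z => minimiser (L ^ n * L ^ C.scale X) (fine L (M (C.scale X))) (aK a L (C.scale X + n))
              (((L ^ n * L ^ C.scale X : ℕ) : ℝ) ^ 2) (mass X) (Pi.single z 1) (xB X))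
            ⬝ᵥ ((effLaplacian (L ^ n * L ^ C.scale X) (fine L (M (C.scale X))) (aK a L (C.scale X + n))
                    (((L ^ n * L ^ C.scale X : ℕ) : ℝ) ^ 2) (mass X)
                  + (a * ((L : ℝ) ^ 2)⁻¹) • blockProj L (M (C.scale X)))⁻¹
                *ᵥ fun w => minimiser (L ^ n * L ^ C.scale X) (fine L (M (C.scale X))) (aK a L (C.scale X + n))
                    (((L ^ n * L ^ C.scale X : ℕ) : ℝ) ^ 2) (mass X) (Pi.single w 1) (yB X)))
        (W : Set (ℕ → ℝ)),
        NE5 EA EB W κ ((L : ℝ) ^ (-(γ / 2))) C₅ := by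
  have hd0 : 0 < d := hd
  have hL2 : 2 ≤ L := by have := hLp.2; omega
  -- the two outer-line packages, MASS INSIDE (§1), BY NAME (rows and columns from ONE decay package)
  obtain ⟨δ₁, c₁, hδ₁, hc₁, H₁⟩ := minimiser_row_decay_unif d L hd hLp ha hm0.le
  obtain ⟨δ₃, c₃, hδ₃, hc₃, H₃⟩ := minimiser_row_rate_unif d L hd hLp.1 hL2 ha hm0.le hγ0 hγ1
  -- one common decay rate for the four outer lines and the middle line
  have hδ45 : 0 < delta45 d a L := delta45_pos (d := d) ha hL2
  set κ : ℝ := min (min δ₁ (δ₃ / 2)) (delta45 d a L) with hκ_def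
  have hκpos : 0 < κ := lt_min (lt_min hδ₁ (half_pos hδ₃)) hδ45
  have hκ₁ : κ ≤ δ₁ := (min_le_left _ _).trans (min_le_left _ _)
  have hκ₃ : κ ≤ δ₃ / 2 := (min_le_left _ _).trans (min_le_right _ _)
  have hκ45 : κ ≤ delta45 d a L := min_le_right _ _
  -- the uniform letters
  set Cu : ℝ := prop38RateConst a a (a * (2 * ((a * (1 - ((L : ℝ) ^ 2)⁻¹))⁻¹ + π ^ 2 / 48 + 1 / 3)))
      ((π ^ 2 / 4) ^ d) d γ + prop38PosConst a ((π ^ 2 / 4) ^ d) d γ with hCu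
  set cR : ℝ := Real.sqrt (2 * (a * c₃) * Cu) with hcR
  have hcR0 : 0 ≤ cR := Real.sqrt_nonneg _
  have hsA : 0 ≤ a * c₁ := by positivity
  have hγ₀ : 0 < gam0L d a L := gam0L_pos ha hL2
  have hK45 : 0 ≤ K45 d a L := K45_nonneg a L
  have hKd : 0 ≤ latticeConst d (κ / 2) := latticeConst_nonneg d (half_pos hκpos).le
  refine ⟨κ / 2, (cR * (2 / gam0L d a L) * (a * c₁) + a * c₁ * K45 d a L * (a * c₁)
      + a * c₁ * (2 / gam0L d a L) * cR) * (latticeConst d (κ / 2)) ^ 2, half_pos hκpos, by positivity, ?_⟩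
  intro n hn M _ hM C hsc xA yA xB yB hx hy hdd mass hmass hcap EA EB hEA hEB W
  have hγ1' : γ / 2 ≤ 1 := by linarith
  -- every scale-`j` torus of the family is the unit torus of the Bałaban volume `(d, L, m_j, K)` for any `K`
  have hvol : ∀ (j K : ℕ), ∃ mm : ℕ, ∀ μ, fine L (M j) μ = (⟨d, L, mm, K, hd, hLp⟩ : Params).sitesPerDir K := fun j K => by
    obtain ⟨mm, hmm⟩ := hM j
    exact ⟨mm, fun μ => by simp only [Params.sitesPerDir, Nat.add_sub_cancel]; exact hmm μ⟩
  refine ne5_of_threeFactorRates_lemma45_massProfile (C := C) (EA := EA) (EB := EB) (W := W) L hL2 ha mass hmass hn M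
    hγ1' hsc
    (fun X => blockOf (L ^ C.scale X) (fine L (M (C.scale X))) (xA X))
    (fun X => blockOf (L ^ C.scale X) (fine L (M (C.scale X))) (yA X))
    (fun X z => minimiser (L ^ C.scale X) (fine L (M (C.scale X))) (aK a L (C.scale X))
      (((L ^ C.scale X : ℕ) : ℝ) ^ 2) (mass X) (Pi.single z 1) (xA X))
    (fun X z => minimiser (L ^ n * L ^ C.scale X) (fine L (M (C.scale X))) (aK a L (C.scale X + n))
      (((L ^ n * L ^ C.scale X : ℕ) : ℝ) ^ 2) (mass X) (Pi.single z 1) (xB X))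
    (fun X w => minimiser (L ^ C.scale X) (fine L (M (C.scale X))) (aK a L (C.scale X))
      (((L ^ C.scale X : ℕ) : ℝ) ^ 2) (mass X) (Pi.single w 1) (yA X))
    (fun X w => minimiser (L ^ n * L ^ C.scale X) (fine L (M (C.scale X))) (aK a L (C.scale X + n))
      (((L ^ n * L ^ C.scale X : ℕ) : ℝ) ^ 2) (mass X) (Pi.single w 1) (yB X))
    (fun X => (effLaplacian (L ^ C.scale X) (fine L (M (C.scale X))) (aK a L (C.scale X))
        (((L ^ C.scale X : ℕ) : ℝ) ^ 2) (mass X) + (a * ((L : ℝ) ^ 2)⁻¹) • blockProj L (M (C.scale X)))⁻¹)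
    (fun X => (effLaplacian (L ^ n * L ^ C.scale X) (fine L (M (C.scale X))) (aK a L (C.scale X + n))
        (((L ^ n * L ^ C.scale X : ℕ) : ℝ) ^ 2) (mass X) + (a * ((L : ℝ) ^ 2)⁻¹) • blockProj L (M (C.scale X)))⁻¹)
    (fun _ => rfl) (fun _ => rfl) hκpos hκ45 hsA hsA hcR0 hcR0 ?_ ?_ ?_ ?_ hdd hEA hEB
  · -- `hu`: run A's row at the mass `mass X` (`minimiser_row_decay_unif`, volume `(d, L, m_j, j)`)
    intro X z
    obtain ⟨mm, hMK⟩ := hvol (C.scale X) (C.scale X)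
    exact H₁ ⟨d, L, mm, C.scale X, hd, hLp⟩ rfl rfl (hsc X) (mass X) (hmass X).le (hcap X)
      (fine L (M (C.scale X))) hMK (L ^ C.scale X) rfl κ hκpos hκ₁ (xA X) z
  · -- `hv`: run B's column at the mass `mass X` (volume `(d, L, m_j, j + n)`), block under `y_B` = `B(y_A)`, `tdistT` symmetric
    intro X w
    obtain ⟨mm, hMK⟩ := hvol (C.scale X) (C.scale X + n)
    have hN : L ^ n * L ^ C.scale X = L ^ (C.scale X + n) := by rw [pow_add, mul_comm]
    have h := H₁ ⟨d, L, mm, C.scale X + n, hd, hLp⟩ rfl rfl (show 1 ≤ C.scale X + n by have := hsc X; omega)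
      (mass X) (hmass X).le (hcap X) (fine L (M (C.scale X))) hMK (L ^ n * L ^ C.scale X) hN κ hκpos hκ₁ (yB X) w
    rw [blockOf_over (fine L (M (C.scale X))) (yA X) (yB X) (hy X), tdistT_symm] at h
    exact h
  · -- `hdu`: the row difference at the mass `mass X` ((3.71) line 1, `minimiser_row_rate_unif`) + `outerRate_le_unif`
    intro X z
    obtain ⟨mm, hMK⟩ := hvol (C.scale X) (C.scale X)
    haveI : NeZero (⟨d, L, mm, C.scale X, hd, hLp⟩ : Params).L := ‹NeZero L›
    have h := H₃ ⟨d, L, mm, C.scale X, hd, hLp⟩ rfl rfl (hsc X) (mass X) (hmass X) (hcap X) n hn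
      (fine L (M (C.scale X))) hMK κ hκpos hκ₃ (xA X) (xB X) z (hx X)
    exact h.trans (mul_le_mul_of_nonneg_right (outerRate_le_unif hd0 ha hL2 (hsc X) hn hγ1 hc₃.le)
      (Real.exp_pos _).le)
  · -- `hdv`: the column difference at the mass `mass X`, by symmetry of the torus distance
    intro X w
    obtain ⟨mm, hMK⟩ := hvol (C.scale X) (C.scale X)
    haveI : NeZero (⟨d, L, mm, C.scale X, hd, hLp⟩ : Params).L := ‹NeZero L›
    have h := H₃ ⟨d, L, mm, C.scale X, hd, hLp⟩ rfl rfl (hsc X) (mass X) (hmass X) (hcap X) n hn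
      (fine L (M (C.scale X))) hMK κ hκpos hκ₃ (yA X) (yB X) w (hy X)
    rw [tdistT_symm (fine L (M (C.scale X))) w]
    exact h.trans (mul_le_mul_of_nonneg_right (outerRate_le_unif hd0 ha hL2 (hsc X) hn hγ1 hc₃.le)
      (Real.exp_pos _).le)

/-! ## §4 King's PHYSICAL profile `m²(L^jη)²` of (2.20): one `(κ, C₅)` for all the slices of a run -/

/-- **The physical slice mass lies under the cap.**  For `L ≥ 1`, `m² ≥ 0` and a domain of scale `j ≤ k` in a run of `k`
steps (`η = eps L k = (L^k)⁻¹`): `m²·(L^j·η)² ≤ m²` — since `L^j·η = L^j∕L^k ≤ 1`. [cite: King1986, (2.20) p.654] -/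
theorem physMass_le_cap {L : ℕ} (hL : 1 ≤ L) {m2 : ℝ} (hm : 0 ≤ m2) {j k : ℕ} (hjk : j ≤ k) :
    m2 * ((L : ℝ) ^ j * eps L k) ^ 2 ≤ m2 := by
  have hL0 : (0 : ℝ) < L := by exact_mod_cast (show 0 < L by omega)
  have hLk : (0 : ℝ) < (L : ℝ) ^ k := pow_pos hL0 k
  have hle : (L : ℝ) ^ j * eps L k ≤ 1 := by
    unfold eps
    rw [← div_eq_mul_inv, div_le_one hLk]
    exact pow_le_pow_right₀ (by exact_mod_cast hL) hjk
  have hnn : 0 ≤ (L : ℝ) ^ j * eps L k := mul_nonneg (pow_nonneg hL0.le _) (eps_pos (show 0 < L by omega) k).le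
  have hsq : ((L : ℝ) ^ j * eps L k) ^ 2 ≤ 1 := by
    rw [← one_pow 2]; exact pow_le_pow_left₀ hnn hle 2
  calc m2 * ((L : ℝ) ^ j * eps L k) ^ 2 ≤ m2 * 1 := mul_le_mul_of_nonneg_left hsq hm
    _ = m2 := mul_one m2

/-- **The physical slice mass is positive** (`m² > 0`, `L ≥ 1`). [cite: King1986, (2.20) p.654] -/
theorem physMass_pos {L : ℕ} (hL : 1 ≤ L) {m2 : ℝ} (hm : 0 < m2) (j k : ℕ) :
    0 < m2 * ((L : ℝ) ^ j * eps L k) ^ 2 := by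
  have hL0 : (0 : ℝ) < L := by exact_mod_cast (show 0 < L by omega)
  exact mul_pos hm (pow_pos (mul_pos (pow_pos hL0 _) (eps_pos (show 0 < L by omega) k)) 2)

/-- **KING'S (3.73), FIRST BOUND, `j ≥ 1`, AT THE PHYSICAL MASSES OF (2.20).**  For `d ≥ 1`, odd `L > 1`, `a > 0`, a physical
mass `m² > 0`, `0 ≤ γ ≤ 1` there are `κ > 0`, `C₅ ≥ 0` (functions of `d, L, a, m², γ`) such that for EVERY run length `k`, every
`n ≥ 1`, volumes, carriers with `1 ≤ scale X ≤ k`, fine points ∕ tree lengths as in §3, and functionals reading the (4.42)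
three-factor graphs of run A (slice `j = scale X` of `G^η_k`, `η = L^{−k} = eps L k`) and run B (slice `j + n` of `G^{η′}_{k+n}`)
AT THE PHYSICAL LATTICE MASS `m²·(L^j·η)²` (the same number for both runs, `L^jη = L^{j+n}η′`): `NE5 EA EB W κ (L^{−γ∕2}) C₅`.
§3 at the profile `mass X = m²·(L^{scale X}·eps L k)²` (`physMass_pos`, `physMass_le_cap`) — the reading in which the slices of
(2.17) carry their (2.20) masses; N18's twin of `N15KingModelSlicesExactMass` §2.  A = 0 MODEL; lattice units of scale `j`.
[cite: King1986, (2.17) p.653, (2.20) p.654, Prop. 3.9 (3.73) p.665, (4.42)–(4.43) p.675] -/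
theorem ne5_kingModel_threeFactor_torus_physMass (hd : 1 ≤ d) (L : ℕ) [NeZero L] (hLp : Odd L ∧ 1 < L) {a m2 : ℝ}
    (ha : 0 < a) (hm : 0 < m2) {γ : ℝ} (hγ0 : 0 ≤ γ) (hγ1 : γ ≤ 1) :
    ∃ κ C₅ : ℝ, 0 < κ ∧ 0 ≤ C₅ ∧
      ∀ (k n : ℕ) (_hn : 1 ≤ n) (M : ℕ → Fin d → ℕ) [∀ j μ, NeZero (M j μ)]
        (_hM : ∀ j, ∃ mm : ℕ, ∀ μ, L * M j μ = 2 * L ^ mm)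
        (C : Carriers) (_hsc : ∀ X, 1 ≤ C.scale X) (_hsk : ∀ X, C.scale X ≤ k)
        (xA yA : (X : C.Dom) → Tor (fine (L ^ C.scale X) (fine L (M (C.scale X)))))
        (xB yB : (X : C.Dom) → Tor (fine (L ^ n * L ^ C.scale X) (fine L (M (C.scale X)))))
        (_hx : ∀ X μ, (xA X μ).val = (xB X μ).val / L ^ n)
        (_hy : ∀ X μ, (yA X μ).val = (yB X μ).val / L ^ n)
        (_hd : ∀ X, C.d X ≤ tdistT (fine L (M (C.scale X)))
            (blockOf (L ^ C.scale X) (fine L (M (C.scale X))) (xA X))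
            (blockOf (L ^ C.scale X) (fine L (M (C.scale X))) (yA X)))
        (EA : Functional C C.BgA) (EB : Functional C C.BgB)
        (_hEA : ∀ g U X, EA g U X =
          (fun z => minimiser (L ^ C.scale X) (fine L (M (C.scale X))) (aK a L (C.scale X))
              (((L ^ C.scale X : ℕ) : ℝ) ^ 2) (m2 * ((L : ℝ) ^ C.scale X * eps L k) ^ 2) (Pi.single z 1) (xA X))
            ⬝ᵥ ((effLaplacian (L ^ C.scale X) (fine L (M (C.scale X))) (aK a L (C.scale X))
                    (((L ^ C.scale X : ℕ) : ℝ) ^ 2) (m2 * ((L : ℝ) ^ C.scale X * eps L k) ^ 2)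
                  + (a * ((L : ℝ) ^ 2)⁻¹) • blockProj L (M (C.scale X)))⁻¹
                *ᵥ fun w => minimiser (L ^ C.scale X) (fine L (M (C.scale X))) (aK a L (C.scale X))
                    (((L ^ C.scale X : ℕ) : ℝ) ^ 2) (m2 * ((L : ℝ) ^ C.scale X * eps L k) ^ 2) (Pi.single w 1) (yA X)))
        (_hEB : ∀ g U X, EB g U X =
          (fun z => minimiser (L ^ n * L ^ C.scale X) (fine L (M (C.scale X))) (aK a L (C.scale X + n))
              (((L ^ n * L ^ C.scale X : ℕ) : ℝ) ^ 2) (m2 * ((L : ℝ) ^ C.scale X * eps L k) ^ 2) (Pi.single z 1) (xB X))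
            ⬝ᵥ ((effLaplacian (L ^ n * L ^ C.scale X) (fine L (M (C.scale X))) (aK a L (C.scale X + n))
                    (((L ^ n * L ^ C.scale X : ℕ) : ℝ) ^ 2) (m2 * ((L : ℝ) ^ C.scale X * eps L k) ^ 2)
                  + (a * ((L : ℝ) ^ 2)⁻¹) • blockProj L (M (C.scale X)))⁻¹
                *ᵥ fun w => minimiser (L ^ n * L ^ C.scale X) (fine L (M (C.scale X))) (aK a L (C.scale X + n))
                    (((L ^ n * L ^ C.scale X : ℕ) : ℝ) ^ 2) (m2 * ((L : ℝ) ^ C.scale X * eps L k) ^ 2)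
                    (Pi.single w 1) (yB X)))
        (W : Set (ℕ → ℝ)),
        NE5 EA EB W κ ((L : ℝ) ^ (-(γ / 2))) C₅ := by
  have hL1 : 1 ≤ L := by have := hLp.2; omega
  obtain ⟨κ, C₅, hκ, hC₅, H⟩ := ne5_kingModel_threeFactor_torus_unif hd L hLp ha hm hγ0 hγ1
  exact ⟨κ, C₅, hκ, hC₅, fun k n hn M _ hM C hsc hsk xA yA xB yB hx hy hdd EA EB hEA hEB W =>
    H n hn M hM C hsc xA yA xB yB hx hy hdd (fun X => m2 * ((L : ℝ) ^ C.scale X * eps L k) ^ 2)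
      (fun X => physMass_pos hL1 hm _ _) (fun X => physMass_le_cap hL1 hm.le (hsk X)) EA EB hEA hEB W⟩

end Summit.QuantumFields.YangMills.BalabanUVNodes.N18KingModelTorusMassUniform

end
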